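import Mathlib
import HarnessLib
import Summits.FinalStateConjecture.Statement

/-!
# Route GlobalAttraction — the deciding crux `CensoredExteriorsSettle` (stmt-FinalStateConjecture-17296)
# cut at the NECK: fixed-radius censored settling ∧ neck completion ⇒ the crux (BC2 redirect, crux-strategist r1)

`GlobalAttraction.CensoredExteriorsSettle` (C2: every maximal vacuum Cauchy development of admissible data with
complete `𝓘⁺` carries an HONEST `C⁰` final-state decomposition — `O = exteriorOf`, `RaysStayInClosure`,
`HasExhaustiveCharts`, `IsFutureOriented`; Komech–Spohn global attraction transplanted, censorship the only
hypothesis) is at least summit-hard as ONE statement (route re-audit 2026-08-16, Reduction axis).  This file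
records, kernel-checked and WITHOUT importing any `Theses` module (so that the gate can link it into the route
file, cf. `Theses/SwallowTheDatum.lean` `WitnessFamilyOfCruxes_holds`), the typed decomposition of C2 along which
the route now attacks it.  The two pieces and the crux are spelled out verbatim (the texts of the route decls
`GlobalAttraction.CensoredFixedRadiusSettle`, `GlobalAttraction.FixedRadiusNecksComplete`,
`GlobalAttraction.CensoredExteriorsSettle`), so that `censoredExteriorsSettle_of_subs` has, up to `δ`-unfolding,
the type `CensoredFixedRadiusSettle → FixedRadiusNecksComplete → CensoredExteriorsSettle` wanted by
`route edit --split CensoredExteriorsSettle --into … --glue-by`.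

* X₁ `CensoredFixedRadiusSettle` (crux; Komech-type LOCAL attraction, all censored data, `C⁰`, `|aᵢ| ≤ Mᵢ`):
  every maximal vacuum Cauchy development of admissible data with complete `𝓘⁺` carries a `C⁰` decomposition
  `d` of `O = exteriorOf 𝒟 d.charted` with `RaysStayInClosure`, `IsFutureOriented d` and the FIXED-SCALE
  honesty bundles `Hc⁰ ∧ Hf` — the `HonestCore`/`HonestFar` clause lists of route StarvedNecks
  (`HonestFixedRadiusSettlingT`, item stmt-FinalStateConjecture-17575) with the sub-extremality conjunct
  removed: near-zone convergence to one boosted Kerr per hole at every FIXED radius (the structure's own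
  clause), a flat radiation zone outside sublinear tubes, anchoring / relative closedness / orientation of
  the charts, no hidden strong field beyond `R₀ ≥ 100 Mᵢ`.  NOTHING is asserted between a fixed radius and
  the flat tubes: no `HasExhaustiveCharts`.
* X₂ `FixedRadiusNecksComplete` (crux; deterministic, RELATIVE to X₁'s output): every such fixed-scale honest
  decomposition `d` COMPLETES ACROSS ITS NECKS — there is a `C⁰` decomposition `d₂` of the SAME `O` extending
  `d` (same holes, masses, spins, motions; the hole charts of `d₂` take the values of those of `d` on the late
  inner regions `{rᵢ ≤ R₀}`), still with `O = exteriorOf 𝒟 d₂.charted` and `IsFutureOriented d₂`, and radii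
  `Rᵢ ≥ R₀' + 4`, `100 Mᵢ ≤ R₀'`, `R₀ ≤ R₀'`, carrying BOTH the `C⁰` certification
  `truncDeviationCk … 0 (Rᵢ τ) τ → 0` AND the causal covering `O ∖ certifiedLate ⊆ J⁻(certifiedSlab)` at every
  `τ₁ > τ₀(d₂)`.  The radii need not grow; no tube bookkeeping is imposed (comoving threshold pairs admitted).
* `censoredExteriorsSettle_of_subs : X₁ → X₂ → C2` — the ASSEMBLY, proved: take X₁'s `d`, complete it by X₂
  into `d₂` (same `O`, so `RaysStayInClosure` is inherited), and manufacture the honest GROWING radii of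
  `HasExhaustiveCharts d₂` (`Rᵢ → ∞`, `max (r₊, 0) + 1 ≤ Rᵢ`) from X₂'s non-growing ones by the diagonal-radii
  upgrade `hasExhaustiveCharts_of_covering₀`: `R'ᵢ τ := max (Rᵢ τ) (Rgᵢ τ)` with `Rgᵢ → ∞` diagonal radii
  (`exists_diagonalRadii`, the diagonal argument of route StarvedNecks' support `DiagonalRadii`, item
  stmt-FinalStateConjecture-13552, re-proved here to keep this module `Theses`-free) of the STRUCTURE's own
  fixed-radius convergence; the truncated deviation at a `max` of radii is the `max` of the deviations
  (monotone in the radius), `certifiedLate`, `certifiedSlab`, `J⁻` are monotone in the radii, and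
  `max (r₊, 0) + 1 ≤ 2Mᵢ + 1 ≤ R₀' + 4 ≤ Rᵢ ≤ R'ᵢ`.

Why the seam is the neck (and not a connective): X₁ certifies each hole chart only out to every FIXED radius —
hence, by the diagonal argument, out to SOME slowly growing radius `Rg(τ)` — and the flat chart only outside
its tubes `ρᵢ(τ)`; nothing in X₁ relates the two scales, so the gap annuli `{Rg < rᵢ ≤ ρᵢ}` are uncontrolled by
X₁ and the covering clause of `HasExhaustiveCharts` cannot hold for radii below `ρᵢ`.  X₂ is exactly the
statement that these annuli are `C⁰`-quiet and causally tame ("between a settled hole and its radiation zone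
lies only Minkowski space", `C⁰` form).  Komech's global attraction is itself a statement in LOCAL seminorms
(A. Komech, *Attractors of Hamiltonian nonlinear PDEs*, book:komech2021, Ch. VI); the radius-uniform upgrade is
the separate matching step.  M. Dafermos, G. Holzegel, I. Rodnianski, M. Taylor, arXiv:2104.08222, §1 (near
zones `{r ≤ R}`); B. O'Neill, *Semi-Riemannian geometry*, 1983, Ch. 14, p. 403 (`J⁻` monotone).
-/

noncomputable section

-- `Summit.FinalStateConjecture.FinalStateConjecture.…` is the tree's mandated namespace (summit = sub-problem).
set_option linter.dupNamespace false

open Set Filter Topology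
open scoped ENNReal Topology Manifold ContDiff
open Literature.Geometry.Lorentzian

namespace Summit.FinalStateConjecture.FinalStateConjecture.Theorems.GlobalAttractionCensoredExteriorsSettleSplit

/-! ### Diagonal radii (the diagonal argument of route StarvedNecks' `DiagonalRadii`, re-proved `Theses`-free) -/

/-- The clipped ramp `x ↦ min c (max 0 (x - s))` is `1`-Lipschitz in the additive form used by
`LipschitzWith.of_le_add`. [folklore] -/
theorem clippedRamp_le_add_dist (c s x y : ℝ) :
    min c (max 0 (x - s)) ≤ min c (max 0 (y - s)) + dist x y := by
  have hd : x - y ≤ dist x y := by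
    rw [Real.dist_eq]
    exact le_abs_self _
  have h0 : (0 : ℝ) ≤ dist x y := dist_nonneg
  have h1 : max 0 (x - s) ≤ max 0 (y - s) + dist x y :=
    max_le (add_nonneg (le_max_left _ _) h0) (by linarith [le_max_right 0 (y - s)])
  calc min c (max 0 (x - s)) ≤ min c (max 0 (y - s) + dist x y) := min_le_min_left _ h1
    _ ≤ min c (max 0 (y - s)) + dist x y := by
        rcases le_total c (max 0 (y - s)) with h | h
        · rw [min_eq_left h]
          exact (min_le_left _ _).trans (le_add_of_nonneg_right h0)
        · rw [min_eq_right h]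
          exact min_le_right _ _

/-- **Slow ramp.** For monotone thresholds `t : ℕ → ℝ` there is a monotone continuous `R : ℝ → ℝ` with
`n ≤ R τ` once `t (n + 1) + n ≤ τ` and `R τ ≤ m` while `τ < t (m + 1)`; witness
`R τ = ⨆ n, min n (max 0 (τ - t (n + 1)))`. [folklore] -/
theorem exists_slow_ramp (t : ℕ → ℝ) (ht : Monotone t) :
    ∃ R : ℝ → ℝ, Monotone R ∧ Continuous R ∧
      (∀ (n : ℕ) (τ : ℝ), t (n + 1) + n ≤ τ → (n : ℝ) ≤ R τ) ∧
      (∀ (m : ℕ) (τ : ℝ), τ < t (m + 1) → R τ ≤ m) := by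
  have hbdd : ∀ τ : ℝ, BddAbove (range fun n : ℕ => min (n : ℝ) (max 0 (τ - t (n + 1)))) := by
    intro τ
    refine ⟨max 0 (τ - t 0), ?_⟩
    rintro _ ⟨n, rfl⟩
    have h0n : t 0 ≤ t (n + 1) := ht (Nat.zero_le _)
    exact min_le_of_right_le (max_le_max le_rfl (by linarith))
  refine ⟨fun τ => ⨆ n : ℕ, min (n : ℝ) (max 0 (τ - t (n + 1))), ?_, ?_, ?_, ?_⟩
  · intro x y hxy
    exact ciSup_le fun n =>
      le_trans (min_le_min_left _ (max_le_max_left _ (sub_le_sub_right hxy _)))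
        (le_ciSup (hbdd y) n)
  · refine (LipschitzWith.of_le_add fun x y => ?_).continuous
    exact ciSup_le fun n =>
      (clippedRamp_le_add_dist (n : ℝ) (t (n + 1)) x y).trans
        (add_le_add (le_ciSup (hbdd y) n) le_rfl)
  · intro n τ hτ
    refine le_trans ?_ (le_ciSup (hbdd τ) n)
    exact le_min le_rfl (le_max_of_le_right (by linarith))
  · intro m τ hτ
    refine ciSup_le fun n => ?_
    rcases le_or_gt n m with hnm | hmn
    · exact min_le_of_left_le (by exact_mod_cast hnm)
    · have h1 : t (m + 1) ≤ t (n + 1) := ht (by omega)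
      have h2 : max 0 (τ - t (n + 1)) = 0 := max_eq_left (by linarith)
      rw [h2]
      exact min_le_of_right_le (Nat.cast_nonneg m)

/-- **Diagonal radii.** If `a : ℝ → ℝ → ℝ≥0∞` is monotone in the radius `ρ` and `a ρ τ → 0` as `τ → ∞`
for every fixed `ρ`, then some monotone continuous `Rg → ∞` has `a (Rg τ) τ → 0` (thresholds `T k` with
`a k τ ≤ k⁻¹` for `τ ≥ T k`, monotone `t k := partialSups T k + k`, the slow ramp, and `a (Rg τ) τ ≤ a m τ ≤ m⁻¹`
for `t m ≤ τ < t (m + 1)`).  Verbatim the landed `DiagonalRadii.diagonalRadii_proof` (route StarvedNecks, item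
stmt-FinalStateConjecture-13552) with its statement spelled out. [folklore] -/
theorem exists_diagonalRadii (a : ℝ → ℝ → ℝ≥0∞) (hmono : ∀ τ, Monotone (fun ρ ↦ a ρ τ))
    (hlim : ∀ ρ, Tendsto (fun τ ↦ a ρ τ) atTop (𝓝 0)) :
    ∃ Rg : ℝ → ℝ, Monotone Rg ∧ Continuous Rg ∧ Tendsto Rg atTop atTop ∧
      Tendsto (fun τ ↦ a (Rg τ) τ) atTop (𝓝 0) := by
  have hT : ∀ k : ℕ, ∃ T : ℝ, ∀ τ ≥ T, a k τ ≤ (k : ℝ≥0∞)⁻¹ := fun k =>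
    ENNReal.tendsto_atTop_zero.1 (hlim k) _ (ENNReal.inv_pos.2 (ENNReal.natCast_ne_top k))
  choose T hT using hT
  obtain ⟨t, ht_mono, hTt, ht_ge⟩ : ∃ t : ℕ → ℝ, Monotone t ∧ (∀ k, T k ≤ t k) ∧
      (∀ k : ℕ, T 0 + k ≤ t k) := by
    refine ⟨fun k => partialSups T k + k, ?_, ?_, ?_⟩
    · intro i j hij
      exact add_le_add ((partialSups T).monotone hij) (by exact_mod_cast hij)
    · intro k
      have h1 : T k ≤ partialSups T k := le_partialSups T k
      have h2 : (0 : ℝ) ≤ k := Nat.cast_nonneg k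
      change T k ≤ partialSups T k + k
      linarith
    · intro k
      have h1 : T 0 ≤ partialSups T k := le_partialSups_of_le T (Nat.zero_le k)
      change T 0 + (k : ℝ) ≤ partialSups T k + k
      linarith
  have ht_top : Tendsto t atTop atTop :=
    tendsto_atTop_mono ht_ge (tendsto_atTop_add_const_left atTop (T 0) tendsto_natCast_atTop_atTop)
  obtain ⟨R, hRmono, hRcont, hRlow, hRup⟩ := exists_slow_ramp t ht_mono
  refine ⟨R, hRmono, hRcont, ?_, ?_⟩
  · refine tendsto_atTop_atTop.2 fun b => ⟨t (⌈b⌉₊ + 1) + ⌈b⌉₊, fun τ hτ => ?_⟩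
    exact (Nat.le_ceil b).trans (hRlow _ _ hτ)
  · rw [ENNReal.tendsto_nhds_zero]
    intro ε hε
    obtain ⟨M, hM⟩ := ENNReal.exists_inv_nat_lt hε.ne'
    filter_upwards [eventually_ge_atTop (t (M + 1))] with τ hτ
    have hex : ∃ n, τ < t n := (ht_top.eventually (eventually_gt_atTop τ)).exists
    classical
    have hn₀ : τ < t (Nat.find hex) := Nat.find_spec hex
    have hMn₀ : M + 1 < Nat.find hex := by
      by_contra h
      exact absurd (hn₀.trans_le (ht_mono (not_lt.1 h))) (not_lt.2 hτ)
    obtain ⟨m, hm⟩ : ∃ m, Nat.find hex = m + 1 := ⟨Nat.find hex - 1, by omega⟩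
    have htm : t m ≤ τ := not_lt.1 (Nat.find_min hex (show m < Nat.find hex by omega))
    have hMm : M ≤ m := by omega
    rw [hm] at hn₀
    calc a (R τ) τ ≤ a m τ := hmono τ (hRup m τ hn₀)
      _ ≤ (m : ℝ≥0∞)⁻¹ := hT m τ ((hTt m).trans htm)
      _ ≤ (M : ℝ≥0∞)⁻¹ := ENNReal.inv_le_inv.2 (by exact_mod_cast hMm)
      _ ≤ ε := hM.le

/-! ### Honest growing radii from non-growing ones (`k = 0`) -/

/-- `r₊ ≤ 2M` for `0 ≤ M` (`√(M² − a²) ≤ M`). O'Neill 1995, Ch. 2, §2.3. [folklore] -/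
theorem rPlus_le_two_mul₀ {M a : ℝ} (hM : 0 ≤ M) : Kerr.rPlus M a ≤ 2 * M := by
  unfold Kerr.rPlus
  have : √(M ^ 2 - a ^ 2) ≤ M := by
    rw [Real.sqrt_le_left hM]
    nlinarith [sq_nonneg a]
  linarith

/-- **Honest growing radii from non-growing ones (`k = 0`).**  If radii `R ≥ R₀ + 4` with `100 Mᵢ ≤ R₀` carry the
`C⁰` certification (clause (i)) and the covering clause (ii) of `HasExhaustiveCharts`, then `HasExhaustiveCharts d`
holds, witnessed by `R'ᵢ τ := max (Rᵢ τ) (Rgᵢ τ)` with `Rgᵢ → ∞` the diagonal radii of the STRUCTURE's own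
fixed-radius convergence (monotone in the radius, `truncDeviationCk_mono`): the truncated deviation at the `max`
of two radii is the `max` of the two deviations; `certifiedLate`, `certifiedSlab` and `J⁻` are monotone in the
radii; `max (r₊, 0) + 1 ≤ 2 Mᵢ + 1 ≤ R₀ + 4 ≤ Rᵢ ≤ R'ᵢ`.  The `k = 0` analogue of route StarvedNecks'
`SeamedChartsExhaust.HonestRadii.hasExhaustiveCharts_of_covering`. DHRT arXiv:2104.08222, §1; O'Neill 1983,
Ch. 14, p. 403. [folklore] -/
theorem hasExhaustiveCharts_of_covering₀ {𝓢 : Spacetime.{0} 4} {O : Set 𝓢.carrier}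
    (d : FinalStateDecomposition 𝓢 O 0) (R : Fin d.N → ℝ → ℝ) (R₀ : ℝ)
    (hR₀ : ∀ i, 100 * d.mass i ≤ R₀) (hR : ∀ i s, R₀ + 4 ≤ R i s)
    (hcert : ∀ i, Tendsto (fun τ ↦ 𝓢.truncDeviationCk (d.background i) (d.chart i) 0 (R i τ) τ)
      atTop (𝓝 0))
    (hcov : ∀ τ₁ : ℝ, d.τ₀ < τ₁ →
      O \ certifiedLate d R τ₁ ⊆ 𝓢.metric.causalPast 𝓢.timeOrientation (certifiedSlab d R τ₁)) :
    HasExhaustiveCharts d := by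
  have hmono : ∀ i τ, Monotone (fun ρ ↦ 𝓢.truncDeviationCk (d.background i) (d.chart i) 0 ρ τ) :=
    fun i τ ρ ρ' h ↦ 𝓢.truncDeviationCk_mono (d.background i) (d.chart i) 0 h τ
  have hRg : ∀ i, ∃ Rg : ℝ → ℝ, Tendsto Rg atTop atTop ∧
      Tendsto (fun τ ↦ 𝓢.truncDeviationCk (d.background i) (d.chart i) 0 (Rg τ) τ) atTop (𝓝 0) := by
    intro i
    obtain ⟨Rg, -, -, htop, hlim⟩ :=
      exists_diagonalRadii (fun ρ τ ↦ 𝓢.truncDeviationCk (d.background i) (d.chart i) 0 ρ τ) (hmono i)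
        (d.tendsto_truncDeviationCk i)
    exact ⟨Rg, htop, hlim⟩
  choose Rg hRg_top hRg_lim using hRg
  have hle : ∀ i τ, R i τ ≤ max (R i τ) (Rg i τ) := fun i τ ↦ le_max_left _ _
  refine ⟨fun i τ ↦ max (R i τ) (Rg i τ), fun i ↦ ⟨?_, fun τ ↦ ?_⟩, fun i ↦ ?_, fun τ₁ hτ₁ ↦ ?_⟩
  · -- the enlarged radii grow: `R' ≥ Rg → ∞`
    exact tendsto_atTop_mono (fun τ ↦ le_max_right _ _) (hRg_top i)
  · -- honest: `max (r₊, 0) + 1 ≤ 2M + 1 ≤ R₀ + 4 ≤ R ≤ R'`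
    have hM : 0 < d.mass i := d.mass_pos i
    have h2M : Kerr.rPlus (d.mass i) (d.spin i) ≤ 2 * d.mass i := rPlus_le_two_mul₀ hM.le
    have hmax : max (Kerr.rPlus (d.mass i) (d.spin i)) 0 ≤ 2 * d.mass i := max_le h2M (by linarith)
    calc max (Kerr.rPlus (d.mass i) (d.spin i)) 0 + 1 ≤ R₀ + 4 := by linarith [hR₀ i]
      _ ≤ R i τ := hR i τ
      _ ≤ max (R i τ) (Rg i τ) := hle i τ
  · -- certification at `R'`: the deviation at `max` of two radii is the `max` of the deviations
    have heq : (fun τ ↦ 𝓢.truncDeviationCk (d.background i) (d.chart i) 0 (max (R i τ) (Rg i τ)) τ) =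
        fun τ ↦ max (𝓢.truncDeviationCk (d.background i) (d.chart i) 0 (R i τ) τ)
          (𝓢.truncDeviationCk (d.background i) (d.chart i) 0 (Rg i τ) τ) := by
      funext τ
      exact (hmono i τ).map_max
    rw [heq]
    simpa using (hcert i).max (hRg_lim i)
  · -- covering at `R'`: `certifiedLate`, `certifiedSlab` and `J⁻` are monotone in the radii
    have hlate : certifiedLate d R τ₁ ⊆ certifiedLate d (fun i τ ↦ max (R i τ) (Rg i τ)) τ₁ := by
      refine union_subset_union_right _ (iUnion_mono fun i ↦ image_mono ?_)
      intro x hx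
      exact ⟨hx.1, hx.2.trans (hle i _)⟩
    have hslab : certifiedSlab d R τ₁ ⊆ certifiedSlab d (fun i τ ↦ max (R i τ) (Rg i τ)) τ₁ :=
      union_subset_union_right _ (iUnion_mono fun i ↦
        image_mono ((d.background i).truncTimeSlab_mono (hle i τ₁) τ₁))
    have hJ : 𝓢.metric.causalPast 𝓢.timeOrientation (certifiedSlab d R τ₁) ⊆
        𝓢.metric.causalPast 𝓢.timeOrientation
          (certifiedSlab d (fun i τ ↦ max (R i τ) (Rg i τ)) τ₁) :=
      LorentzianMetric.causalFuture_mono hslab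
    intro p hp
    exact hJ (hcov τ₁ hτ₁ ⟨hp.1, fun h ↦ hp.2 (hlate h)⟩)

/-! ### The assembly -/

/-- **ASSEMBLY (BC2 redirect of the deciding crux `GlobalAttraction.CensoredExteriorsSettle`).**  Hypotheses:
`h₁` = X₁ `CensoredFixedRadiusSettle` (censorship ⇒ honest fixed-radius `C⁰` settling, all data) and `h₂` = X₂
`FixedRadiusNecksComplete` (every fixed-scale honest decomposition completes across its necks: certification +
covering at common radii `≥ R₀' + 4`, `100 Mᵢ ≤ R₀'`, extending the input), both VERBATIM the route decls' texts;
conclusion: VERBATIM the text of `GlobalAttraction.CensoredExteriorsSettle` (item stmt-FinalStateConjecture-17296).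
Proof: take X₁'s `(O, d, R₀)`; X₂ completes `d` into `d₂` on the same `O` (so `RaysStayInClosure 𝒟 O` is inherited and
`O = exteriorOf 𝒟 d₂.charted`, `IsFutureOriented d₂` are X₂'s); the honest growing radii of `HasExhaustiveCharts d₂`
come from `hasExhaustiveCharts_of_covering₀` (diagonal radii of the structure's fixed-radius convergence, `max` with
X₂'s radii, monotonicity of `certifiedLate` / `certifiedSlab` / `J⁻`). [folklore] -/
theorem censoredExteriorsSettle_of_subs
    (h₁ : open Literature.Geometry.Lorentzian in open scoped ContDiff ENNReal Manifold Topology in let Hc := (fun (𝓢 : Spacetime.{0} 4) (O : Set 𝓢.carrier) (k : ℕ) (d : FinalStateDecomposition 𝓢 O k) (R₀ : ℝ) => let B := d.background; let t := fun i ↦ (B i).time; let r := fun i ↦ (B i).radius; let Ψ := d.chart; (∀ i, 100 * d.mass i ≤ R₀ ∧ 0 < ((d.motion i).1 : E4 ≃L[ℝ] E4) (E4.basisVector 0) 0) ∧ (∀ i (ϱ τ₂ : ℝ), R₀ ≤ ϱ → d.τ₀ < τ₂ → Ψ i '' {x | d.τ₀ < t i x.1 ∧ t i x.1 < τ₂ ∧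 r i x.1 < ϱ} ⊆ 𝓢.metric.causalPast 𝓢.timeOrientation (Ψ i '' (B i).truncTimeSlab ϱ τ₂)) ∧ (∀ i (τ' : ℝ) (ϱ : ℝ → ℝ), Continuous ϱ → d.τ₀ < τ' → let A := Ψ i '' {x | τ' ≤ t i x.1 ∧ r i x.1 ≤ ϱ (t i x.1)}; closure A ∩ O ⊆ A) ∧ (∀ y : d.flatDomain, d.τ₀ < y.1 0 → 𝓢.timeOrientation.IsFutureDirected (mfderiv 𝓘(ℝ, E4) (𝓡 4) d.flatChart y (E4.basisVector 0)))); let Hf := (fun (𝓢 : Spacetime.{0} 4) (O : Set 𝓢.carrier) (k : ℕ) (d : FinalStateDecomposition 𝓢 O k) (R₀ : ℝ) => let B := d.background; let t := fun i ↦ (B i).time; let r := fun i ↦ (B i).radius; let Φ := d.flatChart; (∀ τ₂ : ℝ, d.τ₀ < τ₂ → Φ '' {y | d.τ₀ < y.1 0 ∧ y.1 0 < τ₂} ⊆ 𝓢.metric.causalPast 𝓢.timeOrientation (Φ '' (Minkowski.backgroundOn d.flatDomain).timeSlab τ₂)) ∧ (∀ τ' : ℝ, d.τ₀ < τ' → closure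 (Φ '' {y | τ' ≤ y.1 0 ∧ ∀ i, d.excision i (y.1 0) + 1 ≤ r i y.1}) ⊆ Φ '' {y | τ' ≤ y.1 0}) ∧ (∀ i, ∃ T : ℝ, supCkENorm (Subtype.val '' {x : (B i).domain | T ≤ t i x.1 ∧ R₀ ≤ r i x.1 ∧ ∀ j, j ≠ i → r i x.1 ≤ r j x.1}) 0 (𝓢.deviationExtend (B i) (d.chart i)) ≤ ENNReal.ofReal (1 / (10 * ‖(((d.motion i).1 : E4 ≃L[ℝ] E4) : E4 →L[ℝ] E4)‖ ^ 2)))); ∀ (X : Type) [TopologicalSpace X] [ChartedSpace E3 X] [IsManifold (𝓡 3) ((⊤ : ℕ∞) : WithTop ℕ∞) X] [T2Space X] [SecondCountableTopology X] [ConnectedSpace X], ∀ D ∈ admissibleVacuumData X, ∀ 𝒟 : VacuumCauchyDevelopment D, 𝒟.IsMaximal → Summit.FinalStateConjecture.HasCompleteNullInfinity 𝒟.toCauchyDevelopment → ∃ (O : Set 𝒟.carrier) (d : FinalStateDecomposition 𝒟.toSpacetime O 0) (R₀ : ℝ), O = Summit.FinalStateConjecture.exteriorOf 𝒟.toCauchyDevelopment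 d.charted ∧ Summit.FinalStateConjecture.RaysStayInClosure 𝒟.toCauchyDevelopment O ∧ Summit.FinalStateConjecture.IsFutureOriented d ∧ Hc 𝒟.toSpacetime O 0 d R₀ ∧ Hf 𝒟.toSpacetime O 0 d R₀)
    (h₂ : open Literature.Geometry.Lorentzian in open scoped ContDiff ENNReal Manifold Topology in let Hc := (fun (𝓢 : Spacetime.{0} 4) (O : Set 𝓢.carrier) (k : ℕ) (d : FinalStateDecomposition 𝓢 O k) (R₀ : ℝ) => let B := d.background; let t := fun i ↦ (B i).time; let r := fun i ↦ (B i).radius; let Ψ := d.chart; (∀ i, 100 * d.mass i ≤ R₀ ∧ 0 < ((d.motion i).1 : E4 ≃L[ℝ] E4) (E4.basisVector 0) 0) ∧ (∀ i (ϱ τ₂ : ℝ), R₀ ≤ ϱ → d.τ₀ < τ₂ → Ψ i '' {x | d.τ₀ < t i x.1 ∧ t i x.1 < τ₂ ∧ r i x.1 < ϱ} ⊆ 𝓢.metric.causalPast 𝓢.timeOrientation (Ψ i '' (B i).truncTimeSlab ϱ τ₂)) ∧ (∀ i (τ' : ℝ) (ϱ : ℝ → ℝ), Continuous ϱ → d.τ₀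 < τ' → let A := Ψ i '' {x | τ' ≤ t i x.1 ∧ r i x.1 ≤ ϱ (t i x.1)}; closure A ∩ O ⊆ A) ∧ (∀ y : d.flatDomain, d.τ₀ < y.1 0 → 𝓢.timeOrientation.IsFutureDirected (mfderiv 𝓘(ℝ, E4) (𝓡 4) d.flatChart y (E4.basisVector 0)))); let Hf := (fun (𝓢 : Spacetime.{0} 4) (O : Set 𝓢.carrier) (k : ℕ) (d : FinalStateDecomposition 𝓢 O k) (R₀ : ℝ) => let B := d.background; let t := fun i ↦ (B i).time; let r := fun i ↦ (B i).radius; let Φ := d.flatChart; (∀ τ₂ : ℝ, d.τ₀ < τ₂ → Φ '' {y | d.τ₀ < y.1 0 ∧ y.1 0 < τ₂} ⊆ 𝓢.metric.causalPast 𝓢.timeOrientation (Φ '' (Minkowski.backgroundOn d.flatDomain).timeSlab τ₂)) ∧ (∀ τ' : ℝ, d.τ₀ < τ' → closure (Φ '' {y | τ' ≤ y.1 0 ∧ ∀ i, d.excision i (y.1 0) + 1 ≤ r i y.1}) ⊆ Φ '' {y | τ' ≤ y.1 0}) ∧ (∀ i, ∃ T : ℝ, supCkENorm (Subtype.val ''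 {x : (B i).domain | T ≤ t i x.1 ∧ R₀ ≤ r i x.1 ∧ ∀ j, j ≠ i → r i x.1 ≤ r j x.1}) 0 (𝓢.deviationExtend (B i) (d.chart i)) ≤ ENNReal.ofReal (1 / (10 * ‖(((d.motion i).1 : E4 ≃L[ℝ] E4) : E4 →L[ℝ] E4)‖ ^ 2)))); let Tie := (fun (𝓢 : Spacetime.{0} 4) (O : Set 𝓢.carrier) (d d₂ : FinalStateDecomposition 𝓢 O 0) (R₀ : ℝ) => ∃ e : d.N = d₂.N, ∀ i : Fin d.N, d₂.mass (Fin.cast e i) = d.mass i ∧ d₂.spin (Fin.cast e i) = d.spin i ∧ d₂.motion (Fin.cast e i) = d.motion i ∧ ∀ x : (d.background i).domain, d₂.τ₀ < (d.background i).time x.1 → (d.background i).radius x.1 ≤ R₀ → ∃ y : (d₂.background (Fin.cast e i)).domain, y.1 = x.1 ∧ d₂.chart (Fin.cast e i) y = d.chart i x); ∀ (X : Type) [TopologicalSpace X] [ChartedSpace E3 X] [IsManifold (𝓡 3) ((⊤ : ℕ∞) : WithTop ℕ∞) X] [T2Space X] [SecondCountableTopology X] [ConnectedSpace X], ∀ D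 ∈ admissibleVacuumData X, ∀ 𝒟 : VacuumCauchyDevelopment D, 𝒟.IsMaximal → Summit.FinalStateConjecture.HasCompleteNullInfinity 𝒟.toCauchyDevelopment → ∀ (O : Set 𝒟.carrier) (d : FinalStateDecomposition 𝒟.toSpacetime O 0) (R₀ : ℝ), O = Summit.FinalStateConjecture.exteriorOf 𝒟.toCauchyDevelopment d.charted → Summit.FinalStateConjecture.RaysStayInClosure 𝒟.toCauchyDevelopment O → Summit.FinalStateConjecture.IsFutureOriented d → Hc 𝒟.toSpacetime O 0 d R₀ → Hf 𝒟.toSpacetime O 0 d R₀ → ∃ (d₂ : FinalStateDecomposition 𝒟.toSpacetime O 0) (R : Fin d₂.N → ℝ → ℝ) (R₀' : ℝ), O = Summit.FinalStateConjecture.exteriorOf 𝒟.toCauchyDevelopment d₂.charted ∧ Summit.FinalStateConjecture.IsFutureOriented d₂ ∧ R₀ ≤ R₀' ∧ (∀ i, 100 * d₂.mass i ≤ R₀') ∧ (∀ i s, R₀' + 4 ≤ R i s) ∧ (∀ i, Filter.Tendsto (fun τ ↦ 𝒟.toSpacetime.truncDeviationCk (d₂.background i) (d₂.chart i) 0 (R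 i τ) τ) Filter.atTop (nhds 0)) ∧ (∀ τ₁ : ℝ, d₂.τ₀ < τ₁ → O \ Summit.FinalStateConjecture.certifiedLate d₂ R τ₁ ⊆ 𝒟.toSpacetime.metric.causalPast 𝒟.toSpacetime.timeOrientation (Summit.FinalStateConjecture.certifiedSlab d₂ R τ₁)) ∧ Tie 𝒟.toSpacetime O d d₂ R₀) :
    ∀ (X : Type) [TopologicalSpace X] [ChartedSpace Literature.Geometry.Lorentzian.E3 X] [IsManifold (𝓡 3) ((⊤ : ℕ∞) : WithTop ℕ∞) X] [T2Space X] [SecondCountableTopology X] [ConnectedSpace X], ∀ D ∈ Literature.Geometry.Lorentzian.admissibleVacuumData X, ∀ 𝒟 : Literature.Geometry.Lorentzian.VacuumCauchyDevelopment D, 𝒟.IsMaximal → Summit.FinalStateConjecture.HasCompleteNullInfinity 𝒟.toCauchyDevelopment → ∃ (O : Set 𝒟.carrier) (d : Literature.Geometry.Lorentzian.FinalStateDecomposition 𝒟.toSpacetime O 0), O = Summit.FinalStateConjecture.exteriorOf 𝒟.toCauchyDevelopment d.charted ∧ Summit.FinalStateConjecture.RaysStayInClosure 𝒟.toCauchyDevelopment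 O ∧ Summit.FinalStateConjecture.HasExhaustiveCharts d ∧ Summit.FinalStateConjecture.IsFutureOriented d := by
  intro X _ _ _ _ _ _ D hD 𝒟 hmax hscri
  obtain ⟨O, d, R₀, hO, hRay, hFut, hc, hf⟩ := h₁ X D hD 𝒟 hmax hscri
  obtain ⟨d₂, R, R₀', hO₂, hFut₂, -, hM, hR, hcert, hcov, -⟩ :=
    h₂ X D hD 𝒟 hmax hscri O d R₀ hO hRay hFut hc hf
  exact ⟨O, d₂, hO₂, hRay, hasExhaustiveCharts_of_covering₀ d₂ R R₀' hM hR hcert hcov, hFut₂⟩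

end Summit.FinalStateConjecture.FinalStateConjecture.Theorems.GlobalAttractionCensoredExteriorsSettleSplit

end
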